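import Summits.CriticalPhenomena.SAWScalingLimit.Theses.SAWTotalPositivity

/-!
# Objects and statements of the line `radial-portal-transfer` for the crux
`SAWTotalPositivity.TPToTraversalBound` (stmt-CriticalPhenomena-10687; lead prover, crux protocol;
skeleton `Summits/CriticalPhenomena/SAWScalingLimit/Cruxes/TPToTraversalBound/Lines/radial-portal-transfer.lean`)

The crux is `BoundaryTP2 → CriticalBubbleBound → SAWTraversalBound` (Aizenman–Burchard hypothesis (H1) for
the chordal critical SAW on `δℤ²`). The line pins the walk at a nested family of CLEAN lattice squares
`B_∞(c, N_l δ)`, `N_l = 4^{-l} N_0`: conditioning on the OUTSIDE CONFIGURATION of a box (`outEdgeSet`) is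
the two-sided domain Markov property of the weight `x_c^{|γ|}`, and the state of the resulting chain over
scales is the HEAVINESS — the number of big maximal pieces of the walk outside the box (`HasPieces`).

This file only fixes the VOCABULARY shared by the stub files of the line (so that every stub is stated
over literally the same objects) and a little API:

* `supDist`, `InOpenBox`, `closedBox` — sup-norm lattice boxes and the clean planar square;
* `outEdgeSet γ c N` — the edges of `γ` with both ends outside the open box (the conditioning datum);
* `IsOutsidePiece γ c N i j`, `HasPieces γ c N d m` — maximal index intervals of `γ.walk` outside the open
  box, and "at least `m` of them have sup-diameter `≥ d/2`";
* the five statement interfaces of the line, `CleanContraction`, `HeavinessContraction`, `TopHeaviness`,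
  `InteriorShellBound`, `BoundaryShellBound` (propositions; NOTHING is asserted about them here — the
  registered stubs `stub_*` of the skeleton are the theorems `CleanContraction`,
  `BoundaryTP2 → CriticalBubbleBound → CleanContraction → HeavinessContraction`, `TopHeaviness`,
  `HeavinessContraction → TopHeaviness → InteriorShellBound`, `BoundaryShellBound`, each to be landed in
  its own file importing this one).

Sources: M. Aizenman, A. Burchard, Duke Math. J. 99 (1999) §1.b (traversals, (H1)); A. Kemppainen,
S. Smirnov, Ann. Probab. 45 (2017) §2–3 (Condition G2, annulus crossings); N. Madras, G. Slade, *The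
Self-Avoiding Walk* (1993) §1.2 (domain Markov property of the SAW weights). Deliberately NOT here: any
theorem of the line.
-/

noncomputable section

open MeasureTheory Filter Topology Set Metric
open scoped NNReal ENNReal
open Literature.Probability.LatticeModels
open Literature.Probability.RandomPlanarGeometry
open Literature.Probability.RandomPlanarGeometry.SAW
open Summit.CriticalPhenomena.SAWScalingLimit.Theses.SAWTotalPositivity

namespace Summit.CriticalPhenomena.SAWScalingLimit.Theorems.TPToTraversalBound.Radial

/-! ## Lattice boxes -/

/-- Sup-norm distance on `ℤ²` (lattice units): `max |p₀ - q₀| |p₁ - q₁|`. [folklore] -/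
def supDist (p q : Site 2) : ℤ := max |p 0 - q 0| |p 1 - q 1|

/-- `v` lies in the OPEN lattice box of half-side `N` about `c`: `‖v - c‖_∞ < N`. [folklore] -/
def InOpenBox (c : Site 2) (N : ℕ) (v : Site 2) : Prop := supDist v c < N

/-- The closed planar square of half-side `N δ` about the mesh point of `c` — the region required to be
CLEAN (contained in the domain), so that every lattice point of the closed box is a vertex of `Ω_δ` with
all its box edges. [folklore] -/
def closedBox (δ : ℝ) (c : Site 2) (N : ℕ) : Set ℂ :=
  {z | |z.re - (meshPoint δ c).re| ≤ N * δ ∧ |z.im - (meshPoint δ c).im| ≤ N * δ}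

variable {Ω : Set ℂ} {δ : ℝ} {u v : Site 2}

/-! ## Outside configuration, maximal outside pieces, heaviness -/

/-- The OUTSIDE CONFIGURATION of a SAW relative to the box `(c, N)`: the set of its lattice edges both of
whose endpoints lie outside the open box. Conditioning on it is the two-sided domain Markov property of
the weight `x_c^{|γ|}` (it factorises over edges); as `N` decreases these sets refine each other, so their
atoms generate a filtration over scales. [cite: MadrasSlade1993, §1.2] -/
def outEdgeSet (γ : DomainSAW Ω δ u v) (c : Site 2) (N : ℕ) : Set (Sym2 (Site 2)) :=
  {e | e ∈ γ.walk.edges ∧ ∀ w ∈ e, ¬ InOpenBox c N w}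

/-- The index interval `[i, j]` of the walk is a MAXIMAL PIECE OUTSIDE the open box `(c, N)` (a
portal-to-portal excursion, or the initial / final strand): all its vertices lie outside the open box and
it cannot be extended on either side. [folklore] -/
def IsOutsidePiece (γ : DomainSAW Ω δ u v) (c : Site 2) (N i j : ℕ) : Prop :=
  i ≤ j ∧ j ≤ γ.walk.length ∧ (∀ t, i ≤ t → t ≤ j → ¬ InOpenBox c N (γ.walk.getVert t)) ∧
    (i = 0 ∨ InOpenBox c N (γ.walk.getVert (i - 1))) ∧
    (j = γ.walk.length ∨ InOpenBox c N (γ.walk.getVert (j + 1)))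

/-- HEAVINESS COUNT: the walk has at least `m` distinct maximal pieces outside the open box `(c, N)`
(listed with strictly increasing starting indices), each of sup-diameter at least `d / 2` (lattice units).
With `d = N`: the BIG pieces (the state variable `h_l ≥ m` of the radial chain); with `d = 0`: all pieces
(so `¬ HasPieces γ c N 0 (m+1)` says "at most `m` maximal outside pieces in total").
[cite: AizenmanBurchard1999, §1.b] -/
def HasPieces (γ : DomainSAW Ω δ u v) (c : Site 2) (N d m : ℕ) : Prop :=
  ∃ i j : Fin m → ℕ, StrictMono i ∧ ∀ k, IsOutsidePiece γ c N (i k) (j k) ∧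
    ∃ t t', i k ≤ t ∧ t ≤ j k ∧ i k ≤ t' ∧ t' ≤ j k ∧
      (d : ℤ) ≤ 2 * supDist (γ.walk.getVert t) (γ.walk.getVert t')

/-! ## The five statement interfaces of the line (propositions only) -/

/-- **Clean kernel contraction** (undecorated multi-strand states of the clean ratio-4 square annulus).
There are `θ < 1`, `λ₀ > 0`, `C`, `m₀` such that for every bounded `Ω`, mesh `δ > 0`, endpoints, lattice
box `B_∞(c, 4N)` whose closed planar square lies in `Ω`, and every outside configuration `γ₀` with AT MOST
`m` maximal outside pieces IN TOTAL, the conditional probability (written on the atom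
`{outEdgeSet γ = outEdgeSet γ₀}`) that the walk has `≥ j` big pieces outside the four-times-smaller box
`B_∞(c, N)` is `≤ C 2^{-λ₀ j}` whenever `j ≥ θ m + m₀`. Statement interface of the registered stub
`stub_cleanContraction`; nothing is asserted here. -/
def CleanContraction : Prop :=
  ∃ (θ lam C : ℝ) (m₀ : ℕ), θ < 1 ∧ 0 < lam ∧
    ∀ (Ω : Set ℂ) (δ : ℝ) (u v c : Site 2) (N m j : ℕ) (γ₀ : DomainSAW Ω δ u v),
      Bornology.IsBounded Ω → 0 < δ → 1 ≤ N → closedBox δ c (4 * N) ⊆ Ω →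
      ¬ HasPieces γ₀ c (4 * N) 0 (m + 1) → θ * m + m₀ ≤ (j : ℝ) →
      law Ω δ u v {γ | outEdgeSet γ c (4 * N) = outEdgeSet γ₀ c (4 * N) ∧ HasPieces γ c N N j}
        ≤ ENNReal.ofReal (C * 2 ^ (-(lam * j))) *
          law Ω δ u v {γ | outEdgeSet γ c (4 * N) = outEdgeSet γ₀ c (4 * N)}

/-- **Heaviness contraction** (uniform over decorated outside data — the G2 core). Same inequality, but
the outside configuration `γ₀` is arbitrary except that it has at most `m` BIG pieces (sup-diameter
`≥ 2N`) outside `B_∞(c, 4N)`; any number of small pieces is allowed and must not change `θ, λ₀, C, m₀`.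
Statement interface of the registered stub `stub_decorationRemoval`
(`BoundaryTP2 → CriticalBubbleBound → CleanContraction → HeavinessContraction`); nothing is asserted
here. -/
def HeavinessContraction : Prop :=
  ∃ (θ lam C : ℝ) (m₀ : ℕ), θ < 1 ∧ 0 < lam ∧
    ∀ (Ω : Set ℂ) (δ : ℝ) (u v c : Site 2) (N m j : ℕ) (γ₀ : DomainSAW Ω δ u v),
      Bornology.IsBounded Ω → 0 < δ → 1 ≤ N → closedBox δ c (4 * N) ⊆ Ω →
      ¬ HasPieces γ₀ c (4 * N) (4 * N) (m + 1) → θ * m + m₀ ≤ (j : ℝ) →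
      law Ω δ u v {γ | outEdgeSet γ c (4 * N) = outEdgeSet γ₀ c (4 * N) ∧ HasPieces γ c N N j}
        ≤ ENNReal.ofReal (C * 2 ^ (-(lam * j))) *
          law Ω δ u v {γ | outEdgeSet γ c (4 * N) = outEdgeSet γ₀ c (4 * N)}

/-- **Top state** (one clean scale in the FIXED Dobrushin domain). For every Dobrushin domain and
endpoint approximation there are `C, c₁ > 0, δ₀ > 0` such that for every mesh `δ ≤ δ₀` and every lattice
box `B_∞(c, N)`, `N ≥ 1`, deep inside the domain (`closedBall (δc) (4Nδ) ⊆ D`), the chordal critical SAW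
has `≥ m` big pieces outside the box with probability `≤ C e^{-c₁ m}` (constants depend on `(D, a, b)`).
Statement interface of the registered stub `stub_topHeaviness`; nothing is asserted here. -/
def TopHeaviness : Prop :=
  ∀ (D : DobrushinDomain) (a b : ℝ → Site 2), IsEndpointApprox D a b →
    ∃ (C c₁ δ₀ : ℝ), 0 < c₁ ∧ 0 < δ₀ ∧ ∀ δ ∈ Set.Ioc (0 : ℝ) δ₀, ∀ (c : Site 2) (N m : ℕ),
      1 ≤ N → Metric.closedBall (meshPoint δ c) (4 * N * δ) ⊆ D.carrier →
        law D.carrier δ (a δ) (b δ) {γ | HasPieces γ c N N m}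
          ≤ ENNReal.ofReal (C * Real.exp (-(c₁ * m)))

/-- **(H1) on interior shells, every exponent**: for every `λ > 0`, Dobrushin domain and endpoint
approximation, a shell-dependent threshold `k`, `K ≥ 0`, `δ₀ > 0` with
`P_δ(k(x,ρ,R) separate traversals of D(x; ρ, R)) ≤ K (ρ/R)^λ` for `δ ≤ δ₀`, `δ ≤ ρ < R ≤ 1` and
`closedBall x R ⊆ D`. Statement interface (conclusion of the registered stub `stub_chain`,
`HeavinessContraction → TopHeaviness → InteriorShellBound`); nothing is asserted here. -/
def InteriorShellBound : Prop :=
  ∀ lam : ℝ, 0 < lam → ∀ (D : DobrushinDomain) (a b : ℝ → Site 2), IsEndpointApprox D a b →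
    ∃ (k : ℂ → ℝ → ℝ → ℕ) (K δ₀ : ℝ), 0 ≤ K ∧ 0 < δ₀ ∧ ∀ δ ∈ Set.Ioc (0 : ℝ) δ₀,
      ∀ (x : ℂ) (ρ R : ℝ), δ ≤ ρ → ρ < R → R ≤ 1 → Metric.closedBall x R ⊆ D.carrier →
        law D.carrier δ (a δ) (b δ)
            {γ | (⟨γ.walk.toCurve (meshPoint δ)⟩ : Curve ℂ).HasTraversals (k x ρ R) x ρ R}
          ≤ ENNReal.ofReal (K * (ρ / R) ^ lam)

/-- **(H1) on shells centred outside the domain** (boundary shells), every exponent, shell-dependent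
threshold, constants depending on `(D, a, b)`. Statement interface of the registered stub
`stub_boundaryShells`; nothing is asserted here. -/
def BoundaryShellBound : Prop :=
  ∀ lam : ℝ, 0 < lam → ∀ (D : DobrushinDomain) (a b : ℝ → Site 2), IsEndpointApprox D a b →
    ∃ (k : ℂ → ℝ → ℝ → ℕ) (K δ₀ : ℝ), 0 ≤ K ∧ 0 < δ₀ ∧ ∀ δ ∈ Set.Ioc (0 : ℝ) δ₀,
      ∀ (x : ℂ) (ρ R : ℝ), x ∉ D.carrier → δ ≤ ρ → ρ < R → R ≤ 1 →
        law D.carrier δ (a δ) (b δ)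
            {γ | (⟨γ.walk.toCurve (meshPoint δ)⟩ : Curve ℂ).HasTraversals (k x ρ R) x ρ R}
          ≤ ENNReal.ofReal (K * (ρ / R) ^ lam)

/-! ## Elementary API -/

/-- `supDist` is symmetric. [folklore] -/
theorem supDist_comm (p q : Site 2) : supDist p q = supDist q p := by
  simp only [supDist, abs_sub_comm]

/-- `supDist p p = 0`. [folklore] -/
@[simp] theorem supDist_self (p : Site 2) : supDist p p = 0 := by
  simp [supDist]

/-- `supDist` is nonnegative. [folklore] -/
theorem supDist_nonneg (p q : Site 2) : 0 ≤ supDist p q :=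
  le_max_of_le_left (abs_nonneg _)

/-- Coordinatewise control by `supDist`. [folklore] -/
theorem abs_sub_le_supDist (p q : Site 2) (i : Fin 2) : |p i - q i| ≤ supDist p q := by
  fin_cases i
  · exact le_max_left _ _
  · exact le_max_right _ _

/-- Triangle inequality for `supDist`. [folklore] -/
theorem supDist_triangle (p q r : Site 2) : supDist p r ≤ supDist p q + supDist q r := by
  refine max_le ?_ ?_
  · calc |p 0 - r 0| = |(p 0 - q 0) + (q 0 - r 0)| := by ring_nf
      _ ≤ |p 0 - q 0| + |q 0 - r 0| := abs_add_le _ _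
      _ ≤ supDist p q + supDist q r :=
          add_le_add (abs_sub_le_supDist p q 0) (abs_sub_le_supDist q r 0)
  · calc |p 1 - r 1| = |(p 1 - q 1) + (q 1 - r 1)| := by ring_nf
      _ ≤ |p 1 - q 1| + |q 1 - r 1| := abs_add_le _ _
      _ ≤ supDist p q + supDist q r :=
          add_le_add (abs_sub_le_supDist p q 1) (abs_sub_le_supDist q r 1)

/-- Membership in the open box is decidable (integer comparisons). [folklore] -/
instance instDecidableInOpenBox (c : Site 2) (N : ℕ) (v : Site 2) : Decidable (InOpenBox c N v) :=
  inferInstanceAs (Decidable (supDist v c < N))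

/-- The centre lies in every open box of positive half-side. [folklore] -/
theorem inOpenBox_self {c : Site 2} {N : ℕ} (hN : 1 ≤ N) : InOpenBox c N c := by
  simp only [InOpenBox, supDist_self]
  exact_mod_cast hN

/-- Zero pieces are always present (`Fin 0` is empty). [folklore] -/
theorem hasPieces_zero (γ : DomainSAW Ω δ u v) (c : Site 2) (N d : ℕ) : HasPieces γ c N d 0 :=
  ⟨Fin.elim0, Fin.elim0, fun i => i.elim0, fun k => k.elim0⟩

/-- Fewer pieces are easier: `HasPieces` is antitone in the count. [folklore] -/
theorem HasPieces.of_le {γ : DomainSAW Ω δ u v} {c : Site 2} {N d m m' : ℕ}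
    (h : HasPieces γ c N d m) (hm : m' ≤ m) : HasPieces γ c N d m' := by
  obtain ⟨i, j, hi, hk⟩ := h
  refine ⟨i ∘ Fin.castLE hm, j ∘ Fin.castLE hm, fun a b hab => hi ?_, fun k => hk _⟩
  simpa using hab

/-- Bigger pieces count for every smaller diameter threshold: `HasPieces` is antitone in `d`.
[folklore] -/
theorem HasPieces.mono_d {γ : DomainSAW Ω δ u v} {c : Site 2} {N d d' m : ℕ}
    (h : HasPieces γ c N d m) (hd : d' ≤ d) : HasPieces γ c N d' m := by
  obtain ⟨i, j, hi, hk⟩ := h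
  refine ⟨i, j, hi, fun k => ?_⟩
  obtain ⟨hp, t, t', h1, h2, h3, h4, h5⟩ := hk k
  exact ⟨hp, t, t', h1, h2, h3, h4, le_trans (by exact_mod_cast hd) h5⟩

end Summit.CriticalPhenomena.SAWScalingLimit.Theorems.TPToTraversalBound.Radial

end
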